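import Summits.BirchSwinnertonDyer.BirchSwinnertonDyer.Theorems.KolyvaginRankRigidityAtTwoKolyvaginCorankLowerBoundAtTwoRichOfLossySwap
import Summits.BirchSwinnertonDyer.BirchSwinnertonDyer.Theorems.KolyvaginRankRigidityAtTwoSwapOfNamedFacts
import HarnessLib

/-!
# Crux V2♭∞ `KolyvaginCorankLowerBoundAtTwoRich` (stmt-BirchSwinnertonDyer-27984, route `KolyvaginRankRigidityAtTwo` r3;
# line `kolyvagin_depth_split`) — THE ROUTE DECL FROM ONE NAMED PRINT FACT: Gross 1991 Prop. 3.7 (2)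

`KolyvaginCorankLowerBoundAtTwoRich_of_prop37 (h37 : GrossLMS1991.prop37_2_frobeniusCongruence) :
KolyvaginCorankLowerBoundAtTwoRich` — Kolyvagin's corank lower bound at the prime `2` in the rich (∞) form
(Math. Ann. 291, Thm. 2.2 / 2.3 with relative margins: on the surjective-`2`-adic Heegner habitat, a RICH seed of
depth `ν` with all classes of smaller depth killed by some margin forces `ν + 1 ≤ corank_{ℤ₂} Sel_{2^∞}(E/ℚ)` or
`ν + 1 ≤ corank_{ℤ₂} Sel_{2^∞}(E^{(d_K)}/ℚ)`), BY NAME, as the composition of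
* the width seat's `kolyvaginCorankLowerBoundAtTwoRich_of_lossySwap h37 hS1L` (p640119: depth split, lossy swap
  induction `windowsRich_of_lossySwapTest`, triangular systems, S2–S4, T1 ⇐ Q2 ⇐ Gross 3.7 (2), T2, T3), and
* the lead's `primeSwapAtTwoLossy_of_namedFacts h37` (p640628: S1L = Kolyvagin's prime swap [1] Prop. 8 at `2`,
  lossy form, from Gross 3.7 (2) — P4 unconditional, P5 (krr2-p2), P6, P7, P8 on the hybrid transverse frame,
  Poitou–Tate duality the tree theorem `InputsPoitouTateSelmer.poitouTate_selmerStructure_duality_conj_holds`).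
So the ONLY remaining input of V2♭∞ is the published congruence `prop37_2_frobeniusCongruence` (Gross 1991 Prop. 3.7 (2)
= Nekovář 2007 Prop. 4.9: `y_n ≡ Frob(λ_m) y_m (mod λ_n)`, the Eichler–Shimura relation for Heegner points), cite-only
in the tree. HONEST FRAMING: CONDITIONAL on that named fact (conditional-result: the item closes only when its own
signature is proved, i.e. when `prop37_2_frobeniusCongruence` is discharged); `--supports` 27984; V2♭θ (27220) is NOT
proved; the Birch–Swinnerton-Dyer conjecture is NOT proved by any of this.
References: [cite: Kolyvagin1991MathAnn, §2 Thm. 2.2–2.3, p. 257, p. 259] [cite: McCallumLMS1991, §5 Prop. 5.2]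
[cite: GrossLMS1991, Prop. 3.7 (2)] [cite: Nekovar2007, Prop. 4.9] [cite: WZhang2014, Lemma 8.4].
-/

set_option autoImplicit false
-- the Theorems namespace of this sub repeats the summit name by design (D-0017 nested layout)
set_option linter.dupNamespace false

noncomputable section

open Summit.BirchSwinnertonDyer.BirchSwinnertonDyer.Theses.KolyvaginRankRigidityAtTwo
open Literature.NumberTheory.EllipticCurves.GrossLMS1991 (prop37_2_frobeniusCongruence)

namespace Summit.BirchSwinnertonDyer.BirchSwinnertonDyer.Theorems.KolyvaginLowerBoundAtTwo

/-- **V2♭∞ `KolyvaginCorankLowerBoundAtTwoRich` from Gross 1991 Prop. 3.7 (2)** (Kolyvagin's corank lower bound at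
`2`, rich form, by name): `kolyvaginCorankLowerBoundAtTwoRich_of_lossySwap` (p640119) fed with the lossy prime swap
`primeSwapAtTwoLossy_of_namedFacts` (p640628). CONDITIONAL on the named print fact `prop37_2_frobeniusCongruence`
only; BSD is not proved by this. [cite: Kolyvagin1991MathAnn, §2 Thm. 2.2–2.3] [cite: GrossLMS1991, Prop. 3.7 (2)]
[cite: McCallumLMS1991, §5 Prop. 5.2] -/
theorem KolyvaginCorankLowerBoundAtTwoRich_of_prop37 (h37 : prop37_2_frobeniusCongruence) :
    KolyvaginCorankLowerBoundAtTwoRich :=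
  kolyvaginCorankLowerBoundAtTwoRich_of_lossySwap h37 (primeSwapAtTwoLossy_of_namedFacts h37)

end Summit.BirchSwinnertonDyer.BirchSwinnertonDyer.Theorems.KolyvaginLowerBoundAtTwo

end
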